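import Literature.MathematicalPhysics.QuantumFieldTheory.ConformalBootstrap3D.PointKernelK34L505Data
import Literature.MathematicalPhysics.QuantumFieldTheory.ConformalBootstrap3D.PointKernelK34L505Segs
import Literature.MathematicalPhysics.QuantumFieldTheory.ConformalBootstrap3D.PointKernelParts

/-!
# K34L505 certificate, kernel part file P34: one-cell head segments 100, 101 in level ranges

The head cells whose kernel evaluation exceeds one `decide` are one-cell segments of `hsegsK34L505`; each is
checked by `PCert.hPartSideOK` (side conditions) and `PCert.hPartOK` per level range `[n_lo, n_lo + count)`
against an integer claim, the claims summing to `≥ 0` (`PointKernel.partsOK`); soundness is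
`PCert.hParts_sound` (`PointKernelParts`).  The part files are mutually independent (each imports only
the data file); the ranges of one cell may span several of them, and the per-cell conclusions
`hparts_i` / `hcell_i` of those cells are assembled in `PointKernelK34L505.lean`.
Estimated kernel time 236 s.
-/

set_option maxRecDepth 100000
set_option maxHeartbeats 0

namespace Literature.MathematicalPhysics.QuantumFieldTheory.ConformalBootstrap3D.PointKernelK34L505

open Literature.MathematicalPhysics.QuantumFieldTheory.ConformalBootstrap3D.PointKernel

/-- levels `[64, 68)` of segment 100: partial lower sum `≥` claim. [folklore] -/
theorem part_100_7 : certK34L505.hPartOK (PCert.segAt hsegsK34L505 100) JHK34L505 64 4 (158080826138099693413758156376414744) = true := by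
  decide +kernel

/-- levels `[68, 71)` of segment 100: partial lower sum `≥` claim. [folklore] -/
theorem part_100_8 : certK34L505.hPartOK (PCert.segAt hsegsK34L505 100) JHK34L505 68 3 (72665126817514945809147215457371488) = true := by
  decide +kernel

/-- levels `[71, 73)` of segment 100: partial lower sum `≥` claim. [folklore] -/
theorem part_100_9 : certK34L505.hPartOK (PCert.segAt hsegsK34L505 100) JHK34L505 71 2 (29402162634742928553393867883309347) = true := by
  decide +kernel

/-- one-cell segment 101 (row 6, cell `[3585/512, 14341/2048]`, chord, `n_F = 64`,
6 level ranges): side conditions. [folklore] -/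
theorem pside_101 : certK34L505.hPartSideOK (PCert.segAt hsegsK34L505 101) JHK34L505 = true := by
  decide +kernel

/-- its level ranges `(n_lo, count, claim)`. [folklore] -/
def partsK34L505_101 : List (ℕ × ℕ × ℤ) := [(0, 28, -22022463783665932380287738625098868262), (28, 12, 15661242051097553826603372074812159938), (40, 9, 4261530201851260535078286374263375843), (49, 7, 1373632109146925645542138611502087637), (56, 5, 493076198110447284078849257532354234), (61, 4, 232983223459745088985092306988890615)]

/-- the ranges tile `[0, n_F]` and the claims sum to `≥ 0`. [folklore] -/
theorem pcov_101 : PointKernel.partsOK 64 partsK34L505_101 = true := by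
  decide +kernel

/-- levels `[0, 28)` of segment 101: partial lower sum `≥` claim. [folklore] -/
theorem part_101_0 : certK34L505.hPartOK (PCert.segAt hsegsK34L505 101) JHK34L505 0 28 (-22022463783665932380287738625098868262) = true := by
  decide +kernel

end Literature.MathematicalPhysics.QuantumFieldTheory.ConformalBootstrap3D.PointKernelK34L505
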